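import Literature.NumberTheory.EllipticCurves.TwoAdicImageSurjectivityModTwoProofs
import HarnessLib

/-!
# Halves of the `2`-torsion points: `4(x(Q) − e)² = u′(e)` on any model (proofs only)

Sorry-free `Proofs` companion (two bookkeeping definitions and theorems; no named fact, no
instance; D-0014/D-0026) — the first of three files turning clause (2) of
T. Dokchitser, V. Dokchitser, *Surjectivity of mod `2ⁿ` representations of elliptic curves*,
Math. Z. 272 (2012) 961–964, Theorem, into a kernel theorem.  Their proof of (2) rests on a LEMMA
(loc. cit., p. 962: `Gal(ℚ(E[4])/ℚ)` is conjugate into `ℍ` ⟺ a certain quartic `f` has a rational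
root ⟺ `j = -4t³(t + 8)`) whose printed proof forms `θ_C = Σ_{g ∈ C} x(gP)x(gQ)` over the cosets
`C` of `ℍ` and identifies `∏_C (x - θ_C) = f(4x)` "numerically for a few specialisations … and
rounding the coefficients".  The tree replaces that numerical step by exact algebra on the
abscissae of the HALVES of the `2`-torsion points, and this file supplies the one piece of
curve arithmetic needed — on an ARBITRARY Weierstrass model over any field with `2 ≠ 0`:

* §1 `four_mul_sq_xco_sub_eq` — if `Q + Q = T` with `T ≠ O`, `T + T = O`, then
  `4 (x(Q) - x(T))² = u′(x(T))`, `u′(e) := 12e² + 2b₂e + 2b₄` (`uq`).  Printed source of the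
  ingredients: the duplication formula `x(2Q) = (x⁴ - b₄x² - 2b₆x - b₈)/(4x³ + b₂x² + 2b₄x + b₆)`
  (Silverman, *AEC*, III.2.3 (d)), here taken from Mathlib's group law
  (`Affine.Point.add_self_of_Y_ne`, `slope_of_Y_ne`, `addX`), and `ψ₂²(x(T)) = 0`
  (tree `isRoot_xco_of_add_self_eq_zero`); the conclusion is the classical
  "`x(Q) = e₁ ± √((e₁ - e₂)(e₁ - e₃))` for `2Q = (e₁, 0)`" in model-free form, obtained from the
  polynomial identity `16(φ₂(x) - eψ₂²(x)) - (4(x - e)² - u′(e))² = -4(b₂ + 4e + 8x)·ψ₂²(e)`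
  (certificate found with a computer algebra system, checked here by `linear_combination`).
* §2 two halves of the same `T` have abscissae `x, x'` with `x' = x` or `x + x' = 2x(T)`, and
  `x' = x` iff the halves are `±` each other (`xco_eq_or_add_eq_of_halves`, `xco_eq_iff_of_halves`).
* §3 with `e_i = x(T_i)` the three `2`-torsion abscissae (tree `xT`): `u′(e_i) = 4(e_i - e_j)(e_i - e_k)`
  (`uT_eq`, Vieta for the `2`-division cubic via `roots_twoTorsionPolynomial`), hence
  `u_i ≠ 0`, `4 Σ u_i = c₄`, `u₀u₁u₂ = -64 δ²` (`δ = ∏_{i<j}(e_i - e_j)`, `Δ = 16δ²`), and the `u_i`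
  are pairwise distinct as soon as every `T_i` is moved by some `σ ∈ Γ_K` and `3 ≠ 0`
  (`u_i = u_j ⟺ 3e_k = e₀ + e₁ + e₂ = -b₂/4 ∈ K`) — Dokchitser–Dokchitser's standing hypothesis
  "`b ≠ 0`" of the Lemma in model-free form (`uT_pairwise_ne`).

## References

* [DokchitserDokchitserMathZ2012] T. Dokchitser, V. Dokchitser, Math. Z. 272 (2012) 961–964,
  Lemma (p. 962) and its proof. [corpus:paper:arxiv-1104.5031 p0001 L109–L171]
* [SilvermanAEC2009] J. H. Silverman, *The Arithmetic of Elliptic Curves*, 2nd ed., GTM 106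
  (2009), III.2.3 (d) (duplication formula), III.§1 (`b₂, b₄, b₆, c₄`), Ex. III.3.7.
-/

set_option autoImplicit false

noncomputable section

open scoped Classical

open WeierstrassCurve

namespace Literature.NumberTheory.EllipticCurves.DokchitserDokchitser2012

universe u

variable {K : Type u} [Field K] (W : WeierstrassCurve K)

/-! ### §1. The halving identity on an arbitrary model -/

/-- `u′(e) = 12e² + 2b₂e + 2b₄` (coefficients of the base-changed curve): four times the derivative
at `e` of the monic `2`-division cubic `x³ + (b₂/4)x² + (b₄/2)x + b₆/4`; at a `2`-torsion abscissa
`e_i` it equals `4(e_i - e_j)(e_i - e_k)` (`uT_eq`). Bookkeeping. [folklore] -/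
def uq (e : AlgebraicClosure K) : AlgebraicClosure K :=
  12 * e ^ 2 + 2 * (W.baseChange (AlgebraicClosure K)).b₂ * e +
    2 * (W.baseChange (AlgebraicClosure K)).b₄

/-- **The halving identity.** If `Q + Q = T` with `T ≠ O` and `T + T = O`, then
`4 (x(Q) - x(T))² = u′(x(T))` — the duplication formula (Silverman, *AEC*, III.2.3 (d))
`x(2Q)·ψ₂²(x) = φ₂(x)` with `ψ₂² = 4x³ + b₂x² + 2b₄x + b₆ = (2y + a₁x + a₃)²`,
`φ₂ = x⁴ - b₄x² - 2b₆x - b₈`, combined with `ψ₂²(x(T)) = 0` through the identity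
`16(φ₂(x) - eψ₂²(x)) - (4(x - e)² - u′(e))² = -4(b₂ + 4e + 8x)·ψ₂²(e)`.
[cite: SilvermanAEC2009, III.2.3 (d) (duplication formula)] -/
theorem four_mul_sq_xco_sub_eq {Q T : geomPoints W} (hT0 : T ≠ 0) (hT : T + T = 0)
    (hQ : Q + Q = T) : 4 * (xco W Q - xco W T) ^ 2 = uq W (xco W T) := by
  have hroot := isRoot_xco_of_add_self_eq_zero W hT0 hT
  have hQ0 : Q ≠ 0 := by
    rintro rfl
    rw [add_zero] at hQ
    exact hT0 hQ.symm
  set W' := W.baseChange (AlgebraicClosure K) with hW'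
  change W'.toAffine.Point at Q T
  rcases T with _ | ⟨e, yT, hTns⟩
  · exact absurd rfl hT0
  rcases Q with _ | ⟨x, y, h⟩
  · exact absurd rfl hQ0
  have hQ' : (Affine.Point.some x y h : W'.toAffine.Point) + Affine.Point.some x y h =
      Affine.Point.some e yT hTns := hQ
  have hy : y ≠ W'.toAffine.negY x y := by
    intro hy
    rw [Affine.Point.add_self_of_Y_eq hy] at hQ'
    exact Affine.Point.some_ne_zero _ hQ'.symm
  rw [Affine.Point.add_self_of_Y_ne hy, Affine.Point.some.injEq] at hQ'
  obtain ⟨hx, -⟩ := hQ'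
  simp only [Affine.addX] at hx
  obtain ⟨ℓ, hℓdef⟩ : ∃ ℓ, W'.toAffine.slope x x y y = ℓ := ⟨_, rfl⟩
  rw [hℓdef] at hx
  have hd : y - W'.toAffine.negY x y ≠ 0 := sub_ne_zero.mpr hy
  have hℓ : ℓ * (y - W'.toAffine.negY x y) = 3 * x ^ 2 + 2 * W'.a₂ * x + W'.a₄ - W'.a₁ * y := by
    rw [← hℓdef, Affine.slope_of_Y_ne rfl hy]
    field_simp
  rw [Affine.negY] at hℓ
  have hcurve : y ^ 2 + W'.a₁ * x * y + W'.a₃ * y = x ^ 3 + W'.a₂ * x ^ 2 + W'.a₄ * x + W'.a₆ :=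
    (Affine.equation_iff _ _).mp h.left
  have hr : 4 * e ^ 3 + W'.b₂ * e ^ 2 + 2 * W'.b₄ * e + W'.b₆ = 0 := by
    have h' := hroot
    simp only [xco, twoTorsionPolynomial, Cubic.toPoly, Polynomial.IsRoot.def, Polynomial.eval_add,
      Polynomial.eval_mul, Polynomial.eval_C, Polynomial.eval_pow, Polynomial.eval_X] at h'
    linear_combination h'
  -- `x(2Q)·(2y + a₁x + a₃)² = n² + a₁ n (2y + a₁x + a₃) - (a₂ + 2x)(2y + a₁x + a₃)²`
  have hA : e * (2 * y + W'.a₁ * x + W'.a₃) ^ 2 =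
      (3 * x ^ 2 + 2 * W'.a₂ * x + W'.a₄ - W'.a₁ * y) ^ 2 +
        W'.a₁ * (3 * x ^ 2 + 2 * W'.a₂ * x + W'.a₄ - W'.a₁ * y) * (2 * y + W'.a₁ * x + W'.a₃) -
          (W'.a₂ + 2 * x) * (2 * y + W'.a₁ * x + W'.a₃) ^ 2 := by
    linear_combination (-(2 * y + W'.a₁ * x + W'.a₃) ^ 2) * hx +
      (ℓ * (2 * y + W'.a₁ * x + W'.a₃) + (3 * x ^ 2 + 2 * W'.a₂ * x + W'.a₄ - W'.a₁ * y) +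
        W'.a₁ * (2 * y + W'.a₁ * x + W'.a₃)) * hℓ
  change 4 * (x - e) ^ 2 = uq W e
  have key : (4 * (x - e) ^ 2 - uq W e) ^ 2 = 0 := by
    simp only [uq, ← hW', WeierstrassCurve.b₂, WeierstrassCurve.b₄, WeierstrassCurve.b₆] at hr ⊢
    linear_combination (-16) * hA + (16 * ((W'.a₁ ^ 2 + 4 * W'.a₂) + 8 * x) + 64 * e) * hcurve +
      4 * ((W'.a₁ ^ 2 + 4 * W'.a₂) + 4 * e + 8 * x) * hr
  exact sub_eq_zero.mp ((pow_eq_zero_iff two_ne_zero).mp key)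

/-! ### §2. Two halves of the same `T` -/

/-- `x(-P) = x(P)` (the negation formula `-(x, y) = (x, -y - a₁x - a₃)`).
[cite: SilvermanAEC2009, III.2.3 (a) (negation formula)] -/
theorem xco_neg (P : geomPoints W) : xco W (-P) = xco W P := by
  change (W.baseChange (AlgebraicClosure K)).toAffine.Point at P
  rcases P with _ | ⟨x, y, h⟩
  · rfl
  · rfl

/-- Two nonzero points with the same abscissa are `±` each other.
[cite: SilvermanAEC2009, III.2.3 (points with equal abscissa are P or −P)] -/
theorem eq_or_eq_neg_of_xco_eq {P Q : geomPoints W} (hP0 : P ≠ 0) (hQ0 : Q ≠ 0)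
    (h : xco W P = xco W Q) : P = Q ∨ P = -Q := by
  change (W.baseChange (AlgebraicClosure K)).toAffine.Point at P Q
  rcases P with _ | ⟨x₁, y₁, h₁⟩
  · exact absurd rfl hP0
  rcases Q with _ | ⟨x₂, y₂, h₂⟩
  · exact absurd rfl hQ0
  exact (Affine.Point.X_eq_iff (h₁ := h₁) (h₂ := h₂)).mp h

/-- **Two halves `Q, H` of the same `T ≠ O` (`T + T = O`) have `x(Q) = x(H)` or
`x(Q) + x(H) = 2x(T)`** (both satisfy `4(x - e)² = u′(e)`; `2 ≠ 0`).
[cite: DokchitserDokchitserMathZ2012, Lemma (p. 962), proof (the abscissae of the 4-torsion points)] -/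
theorem xco_eq_or_add_eq_of_halves (h2 : (2 : K) ≠ 0) {Q H T : geomPoints W} (hT0 : T ≠ 0)
    (hT : T + T = 0) (hQ : Q + Q = T) (hH : H + H = T) :
    xco W Q = xco W H ∨ xco W Q + xco W H = 2 * xco W T := by
  have h2' : (2 : AlgebraicClosure K) ≠ 0 := fun h0 ↦
    h2 ((algebraMap K (AlgebraicClosure K)).injective (by rw [map_ofNat, h0, map_zero]))
  have hq := four_mul_sq_xco_sub_eq W hT0 hT hQ
  have hh := four_mul_sq_xco_sub_eq W hT0 hT hH
  have hsq : (2 * (xco W Q - xco W T)) ^ 2 = (2 * (xco W H - xco W T)) ^ 2 := by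
    linear_combination hq - hh
  rcases eq_or_eq_neg_of_sq_eq_sq _ _ hsq with h | h
  · left
    have := mul_left_cancel₀ h2' h
    linear_combination this
  · right
    have h' : 2 * (xco W Q + xco W H - 2 * xco W T) = 0 := by linear_combination h
    have := (mul_eq_zero.mp h').resolve_left h2'
    linear_combination this

/-- **Two halves `Q, H` of `T ≠ O` have the same abscissa iff `Q = ±H`.**
[cite: SilvermanAEC2009, III.2.3 (points with equal abscissa are P or −P)] -/
theorem xco_eq_iff_of_halves {Q H T : geomPoints W} (hT0 : T ≠ 0)
    (hQ : Q + Q = T) (hH : H + H = T) :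
    xco W Q = xco W H ↔ Q = H ∨ Q = -H := by
  have hQ0 : Q ≠ 0 := by rintro rfl; rw [add_zero] at hQ; exact hT0 hQ.symm
  have hH0 : H ≠ 0 := by rintro rfl; rw [add_zero] at hH; exact hT0 hH.symm
  refine ⟨eq_or_eq_neg_of_xco_eq W hQ0 hH0, ?_⟩
  rintro (rfl | rfl)
  · rfl
  · exact xco_neg W H

/-! ### §3. `u_i = u′(e_i) = 4(e_i - e_j)(e_i - e_k)`: Vieta for the `2`-division cubic -/

variable [W.IsElliptic] (h2 : (2 : K) ≠ 0)

/-- `u_i := u′(e_i)`, `e_i = x(T_i)` (bookkeeping). [folklore] -/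
def uT (i : Fin 3) : AlgebraicClosure K := uq W (xT W h2 i)

include h2 in
/-- `2 ≠ 0` and `4 ≠ 0` in `K̄`. [folklore] -/
private theorem two_four_ne_zero :
    (2 : AlgebraicClosure K) ≠ 0 ∧ (4 : AlgebraicClosure K) ≠ 0 := by
  have h2' : (2 : AlgebraicClosure K) ≠ 0 := fun h0 ↦
    h2 ((algebraMap K (AlgebraicClosure K)).injective (by rw [map_ofNat, h0, map_zero]))
  exact ⟨h2', by rw [show (4 : AlgebraicClosure K) = 2 * 2 by norm_num]; exact mul_ne_zero h2' h2'⟩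

/-- **Vieta for the `2`-division cubic** `4x³ + b₂x² + 2b₄x + b₆ = 4 ∏ (x - e_i)`:
`b₂ = -4 Σ e_i`, `b₄ = 2 Σ_{i<j} e_ie_j`, `b₆ = -4 e₀e₁e₂` (in `K̄`).
[cite: SilvermanAEC2009, Ex. III.3.7 (d) (the roots of ψ₂² are the 2-torsion abscissae)] -/
theorem vieta_twoTorsion :
    (W.baseChange (AlgebraicClosure K)).b₂ = -4 * (xT W h2 0 + xT W h2 1 + xT W h2 2) ∧
      (W.baseChange (AlgebraicClosure K)).b₄ =
        2 * (xT W h2 0 * xT W h2 1 + xT W h2 0 * xT W h2 2 + xT W h2 1 * xT W h2 2) ∧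
      (W.baseChange (AlgebraicClosure K)).b₆ = -4 * (xT W h2 0 * xT W h2 1 * xT W h2 2) := by
  obtain ⟨h2', -⟩ := two_four_ne_zero (K := K) h2
  have ha : W.twoTorsionPolynomial.a ≠ 0 := by
    change (4 : K) ≠ 0
    rw [show (4 : K) = 2 * 2 by norm_num]; exact mul_ne_zero h2 h2
  have h3 := roots_twoTorsionPolynomial W h2
  have hb := Cubic.b_eq_three_roots ha h3
  have hc := Cubic.c_eq_three_roots ha h3
  have hd := Cubic.d_eq_three_roots ha h3
  simp only [twoTorsionPolynomial, map_ofNat, map_mul] at hb hc hd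
  simp only [baseChange, map_b₂, map_b₄, map_b₆]
  refine ⟨by linear_combination hb, ?_, by linear_combination hd⟩
  apply mul_left_cancel₀ h2'
  linear_combination hc

/-- **`u_i = 4(e_i - e_j)(e_i - e_k)`.** [cite: SilvermanAEC2009, Ex. III.3.7 (d)] -/
theorem uT_eq :
    uT W h2 0 = 4 * ((xT W h2 0 - xT W h2 1) * (xT W h2 0 - xT W h2 2)) ∧
      uT W h2 1 = 4 * ((xT W h2 1 - xT W h2 0) * (xT W h2 1 - xT W h2 2)) ∧
      uT W h2 2 = 4 * ((xT W h2 2 - xT W h2 0) * (xT W h2 2 - xT W h2 1)) := by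
  obtain ⟨hb, hc, -⟩ := vieta_twoTorsion W h2
  simp only [uT, uq, hb, hc]
  exact ⟨by ring, by ring, by ring⟩

/-- **`u₀ u₁ u₂ = -64 δ²`** with `δ = (e₀ - e₁)(e₀ - e₂)(e₁ - e₂)` (so `Δ = 16 δ²`,
tree `algebraMap_Δ`). [cite: SilvermanAEC2009, III.§1 (Δ and the discriminant of the 2-division cubic)] -/
theorem prod_uT : uT W h2 0 * uT W h2 1 * uT W h2 2 = -64 * delta W h2 ^ 2 := by
  obtain ⟨h0, h1, h2e⟩ := uT_eq W h2
  rw [h0, h1, h2e, delta]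
  ring

/-- `u_i ≠ 0` (the `e_i` are distinct, `2 ≠ 0`).
[cite: SilvermanAEC2009, III.2.3 (points with equal abscissa are P or −P)] -/
theorem uT_ne_zero (i : Fin 3) : uT W h2 i ≠ 0 := by
  obtain ⟨-, h4'⟩ := two_four_ne_zero (K := K) h2
  have h64 : (-64 : AlgebraicClosure K) ≠ 0 := by
    rw [show (-64 : AlgebraicClosure K) = -(4 * 4 * 4) by norm_num, neg_ne_zero]
    exact mul_ne_zero (mul_ne_zero h4' h4') h4'
  have hprod : uT W h2 0 * uT W h2 1 * uT W h2 2 ≠ 0 := by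
    rw [prod_uT]
    exact mul_ne_zero h64 (pow_ne_zero 2 (delta_ne_zero W h2))
  fin_cases i
  · exact fun h ↦ hprod (by rw [show uT W h2 0 = 0 from h, zero_mul, zero_mul])
  · exact fun h ↦ hprod (by rw [show uT W h2 1 = 0 from h, mul_zero, zero_mul])
  · exact fun h ↦ hprod (by rw [show uT W h2 2 = 0 from h, mul_zero])

/-- **`4 (u₀ + u₁ + u₂) = c₄`** (`c₄ = b₂² - 24b₄`). [cite: SilvermanAEC2009, III.§1 (c₄ = b₂² − 24 b₄)] -/
theorem four_mul_sum_uT :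
    4 * (uT W h2 0 + uT W h2 1 + uT W h2 2) = algebraMap K (AlgebraicClosure K) W.c₄ := by
  obtain ⟨hb, hc, -⟩ := vieta_twoTorsion W h2
  have h4 : algebraMap K (AlgebraicClosure K) W.c₄ = (W.baseChange (AlgebraicClosure K)).c₄ := by
    simp only [baseChange, map_c₄]
  rw [h4, c₄, hb, hc]
  simp only [uT, uq, hb, hc]
  ring

/-- A `2`-torsion abscissa `e_k` whose point `T_k` is moved by some `σ ∈ Γ_K` is not in `K`
(`σ e_k = e_{σ k}`). [cite: SilvermanAEC2009, VIII.§1 (G_{K̄/K} acts on E(K̄) coordinatewise)] -/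
theorem xT_ne_algebraMap {k : Fin 3}
    (hmove : ∃ σ : Field.absoluteGaloisGroup K, σ • T W h2 k ≠ T W h2 k) (q : K) :
    xT W h2 k ≠ algebraMap K (AlgebraicClosure K) q := by
  obtain ⟨σ, hσ⟩ := hmove
  intro hk
  apply hσ
  have hfix : σ • xT W h2 k = xT W h2 k := by
    rw [hk]; exact (show AlgebraicClosure K ≃ₐ[K] AlgebraicClosure K from σ).commutes q
  rw [smul_xT] at hfix
  rw [← T_permGal, xT_injective W h2 hfix]

/-- **The `u_i` are pairwise distinct when every `T_k` is moved by some `σ ∈ Γ_K` and `3 ≠ 0`:**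
`u_i - u_j = 4(e_i - e_j)(e_i + e_j - 2e_k)`, and `e_i + e_j = 2e_k` would put
`e_k = (e₀ + e₁ + e₂)/3 = -b₂/12` in `K`. Dokchitser–Dokchitser's hypothesis "`b ≠ 0`" of the
Lemma (for `y² = x³ + ax + b`: `b = 0 ⟺ some e_k = 0 = -b₂/12`), model-free.
[cite: DokchitserDokchitserMathZ2012, Lemma (p. 962) (hypothesis b ≠ 0)] -/
theorem uT_pairwise_ne (h3 : (3 : K) ≠ 0)
    (hmove : ∀ k : Fin 3, ∃ σ : Field.absoluteGaloisGroup K, σ • T W h2 k ≠ T W h2 k) :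
    uT W h2 0 ≠ uT W h2 1 ∧ uT W h2 0 ≠ uT W h2 2 ∧ uT W h2 1 ≠ uT W h2 2 := by
  obtain ⟨hb, -, -⟩ := vieta_twoTorsion W h2
  obtain ⟨-, h4'⟩ := two_four_ne_zero (K := K) h2
  obtain ⟨h0, h1, h2e⟩ := uT_eq W h2
  have h3' : (3 : AlgebraicClosure K) ≠ 0 := fun h0 ↦
    h3 ((algebraMap K (AlgebraicClosure K)).injective (by rw [map_ofNat, h0, map_zero]))
  have h12 : (12 : AlgebraicClosure K) ≠ 0 := by
    rw [show (12 : AlgebraicClosure K) = 3 * 4 by norm_num]; exact mul_ne_zero h3' h4'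
  have hne : ∀ i j : Fin 3, i ≠ j → xT W h2 i - xT W h2 j ≠ 0 := fun i j hij ↦
    sub_ne_zero.mpr ((xT_injective W h2).ne hij)
  have hb' : algebraMap K (AlgebraicClosure K) W.b₂ = -4 * (xT W h2 0 + xT W h2 1 + xT W h2 2) := by
    rw [← hb]; simp only [baseChange, map_b₂]
  -- `a + b = 2 e_k` for the two other abscissae `a, b` would put `e_k = -b₂/12` in `K`
  have aux : ∀ k : Fin 3, ∀ a b : AlgebraicClosure K,
      a + b + xT W h2 k = xT W h2 0 + xT W h2 1 + xT W h2 2 → a + b - 2 * xT W h2 k ≠ 0 := by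
    intro k a b hsum hzero
    refine xT_ne_algebraMap W h2 (hmove k) (-W.b₂ / 12) ?_
    rw [map_div₀, map_neg, map_ofNat, eq_div_iff h12, hb']
    linear_combination (-4) * hzero + 4 * hsum
  refine ⟨fun hu ↦ ?_, fun hu ↦ ?_, fun hu ↦ ?_⟩
  · refine aux 2 (xT W h2 0) (xT W h2 1) (by ring) ?_
    have : 4 * (xT W h2 0 - xT W h2 1) * (xT W h2 0 + xT W h2 1 - 2 * xT W h2 2) = 0 := by
      rw [h0, h1] at hu; linear_combination hu
    exact (mul_eq_zero.mp this).resolve_left (mul_ne_zero h4' (hne 0 1 (by decide)))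
  · refine aux 1 (xT W h2 0) (xT W h2 2) (by ring) ?_
    have : 4 * (xT W h2 0 - xT W h2 2) * (xT W h2 0 + xT W h2 2 - 2 * xT W h2 1) = 0 := by
      rw [h0, h2e] at hu; linear_combination hu
    exact (mul_eq_zero.mp this).resolve_left (mul_ne_zero h4' (hne 0 2 (by decide)))
  · refine aux 0 (xT W h2 1) (xT W h2 2) (by ring) ?_
    have : 4 * (xT W h2 1 - xT W h2 2) * (xT W h2 1 + xT W h2 2 - 2 * xT W h2 0) = 0 := by
      rw [h1, h2e] at hu; linear_combination hu
    exact (mul_eq_zero.mp this).resolve_left (mul_ne_zero h4' (hne 1 2 (by decide)))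

end Literature.NumberTheory.EllipticCurves.DokchitserDokchitser2012

end
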